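import Summits.FinalStateConjecture.FinalStateConjecture.Theorems.NearExtremalKappaCapture.Negative.ExponentMonotonicity
import Literature.Geometry.Lorentzian.KerrSurfaceGravity

/-!
# Line `area-excess-ratchet` — registered skeleton for crux `NearExtremalKappaCapture`
# (stmt-FinalStateConjecture-10606, route PhaseMixingCapture; crux-plan, round 1)

planner-cruxplan-stmt-FinalStateConjecture-10606-area-excess-ratchet-0 · 2026-08-16 · idea card
`Cruxes/NearExtremalKappaCapture/Ideas/area-excess-ratchet.md` (ideator 1) · triage r1: pass ×3 (sharpenings
adopted, see the line card `Lines/area-excess-ratchet.md`).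

THE LINE. The crux asks for κ-polynomial capture of near-extremal Kerr: basin `c χ^γ`, `Cᵏ` convergence to a
SUB-extremal Kerr, far-complete `𝓘⁺`, modulus `|M′−M|+|a′−a| ≤ C χ^{-p} √dist` (`χ = 1 − a²/M² ≍ (Mκ)²`). The
idea's lever: the black-hole CHARGES are pinned by conservation / monotonicity laws read OFF the bootstrap —
mass from above by Bondi loss (`M′ ≤ E_ADM = M`), HORIZON AREA from below by Hawking's area theorem against a
trapped collar of the initial slice (`A′/8π = M′r₊(M′,a′) ≥ M r₊(M,a) − C M² χ^{-q} √dist`, the RATCHET),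
angular momentum by flux bookkeeping (`|a′M′ − aM| ≤ C χ^{-q} √dist`; exact Komar conservation in axisymmetry);
all budgets in the crux's own `χ^{-q}√dist` convention (in truth linear/quadratic in the amplitude `dist`). Because the
Kerr area is STEEP in the mass at fixed `J` near extremality (first law: `∂(A/8π)/∂M|_J ≍ M/√χ`), the three
budgets pin `(M′, a′)` with a modulus whose only `κ`-loss is the flux/deficit exponent `q` (real arithmetic,
`modulus_of_budgets`, PROVED below), and the pinned drift `≤ Mχ/4` makes the limit sub-extremal with comparable
temperature (`isSubextremal_of_drift`, the landed redundancy lemma p74448, re-proved inline). What is LEFT for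
the analytic engine is orbital capture by the CLOSED Kerr family with angular-momentum bookkeeping but WITHOUT
mass modulus, WITHOUT sub-extremality / no-parking control and WITHOUT completeness of `𝓘⁺`
(`stub_closedFamilyCapture`, hardest), plus the causal-geometric step capture ⇒ far-completeness
(`stub_farCompleteness`).

STUBS (the only `sorry`s; each fully unfolded over tree vocabulary + the landed `Negative.FarComplete`):
* `stub_closedFamilyCapture` — ENGINE (hardest, load-bearing): `∃ a₁ < 1, ∀ k, ∃ N₀ q, ∀ s δ γ ≥ N₀`, basin
  `c χ^γ` in `H^s_δ` ⇒ every MGHD contains a late region `Cᵏ`-converging (Kerr–Schild pullback gauge) to SOME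
  Kerr `(M′, a′)` of the CLOSED family `0 < M′, |a′| ≤ M′`, with `|a′M′ − aM| ≤ C χ^{-q} √dist`.
* `stub_farCompleteness` — a maximal development of basin data containing such a late Kerr end has complete `𝓘⁺`
  in Christodoulou's sojourn form (`FarComplete`).
* `stub_massBound` — NO MASS GAIN: `M′ ≤ M + C χ^{-q} √dist` (Bondi mass loss; `E_ADM` pinned for large `δ`, `C = 0`
  expected).
* `stub_areaRatchet` — AREA RATCHET: `M r₊(M,a) − C M² χ^{-q} √dist ≤ M′ r₊(M′,a′)` (trapped-collar certificate
  in the data + trapped surfaces are swallowed + CDGH area theorem + final horizon area `= 8π M′r₊′`).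
COMPOSITION (kernel-checked, no `sorry` of its own): `captureWith_of_stubs` (exponents `s = δ = γ = N`,
`N = ΣN₀ + 2q + 2`, `k = Σk₀`, `p = q = q_E + q_α + q_β`; basin constant shrunk so that the budgets are small) and
`NearExtremalKappaCapture_of : Theses.PhaseMixingCapture.NearExtremalKappaCapture` BY NAME via the landed
read-back `Negative.near_iff` (p73006).

Disproof.lean (cdisprove v3, 2026-08-16; no `_false_without_` theorem exists, verdict "no kill") honoured:
§2 up-set/`near_iff_diagonal` — the composition works on the diagonal `s = δ = γ = N`, `p = q`; §3
`captureWith_self` — at `dist = 0` all budgets vanish and `(M′,a′) = (M,a)`; §4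
`captureWith_false_of_extremalFormation` + `Negative/SubextremalRedundancy` — sub-extremality of the limit is not
sold as a deliverable: it is RE-DERIVED from the pinned drift (`≤ Mχ/4 < M − |a|`), and the line is the mechanism
defeating `ExtremalFormationInBasin` for `γ ≥ 2q + 2` granted the stubs; §5 `near_iff_germ` — the engine stub is
stated on a punctured neighbourhood `a₁M ≤ |a| < M` of extremality only (the bulk is crux #4); §6
`captureWith_false_of_lighterMembers` ("any proof uses `γ ≥ 1` or `δ ≥ −1/2`") — the composition has
`γ = N ≥ 2`, `δ = N ≥ N₀`, and the exterior-truncated lighter members (whose MGHDs contain no late Kerr slab and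
are not far-complete) lie outside every stub's basin once `N₀ ≤ δ`; §7 `near_iff_exists` — both instance binders
are dischargeable, the stubs carry them as ordinary instance arguments. The `IsSubextremal M a` hypothesis
(`χ > 0`) is used in every stub's basin and in `kappaSq_pos_le_one`. Negatives index: 0 refuted statements
(2026-08-16). No landed `Negative/` lemma refutes any stub: both landed modules (`ExponentMonotonicity`,
`SubextremalRedundancy`) are normal-form / redundancy results, imported resp. re-proved here.
-/

noncomputable section

set_option linter.dupNamespace false

namespace Summit.FinalStateConjecture.FinalStateConjecture.Cruxes.NearExtremalKappaCapture.AreaExcessRatchet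

open Literature.Geometry.Lorentzian
open Summit.FinalStateConjecture.FinalStateConjecture.Theorems.NearExtremalKappaCapture.Negative
open scoped Manifold ContDiff Topology ENNReal
open Set Filter

/-! ## Registered stubs (the only `sorry`s of the line) -/

/-- **Stub E — `stub_closedFamilyCapture` (ENGINE; hardest, load-bearing).** κ-polynomial orbital capture of
near-extremal Kerr by the CLOSED Kerr family, with angular-momentum bookkeeping and NOTHING ELSE: there is
`a₁ < 1` such that for every convergence order `k` there are thresholds `N₀, q` with: for all `s ≥ N₀`,
`δ ≥ N₀`, `γ ≥ N₀` and every `M > 0` there are `c > 0`, `C` such that every vacuum datum `D` on the Kerr–Schild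
slice `{t* = 0, r > M}` with `dist_{H^s_δ}(D, Kerr(M,a)) < c (1 − a²/M²)^γ`, `a₁M ≤ |a| < M`, has all its maximal
vacuum Cauchy developments containing a late region `𝒟oc` converging in `Cᵏ` (Kerr–Schild pullback gauge,
`Spacetime.ConvergesToKerr`) to SOME Kerr exterior `g_{M′,a′}` with `0 < M′`, `|a′| ≤ M′` (extremal limits
allowed!) and `|a′M′ − aM| ≤ C (1 − a²/M²)^{-q} √dist` (the crux's own modulus convention; radiated angular
momentum is quadratic in the perturbation amplitude `dist`, with κ-polynomial constant; `= 0` in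
axisymmetry by Komar). NOT asked: any bound on `M′ − M`,
sub-extremality or temperature of the limit, completeness of `𝓘⁺` — these are supplied by the laws below, so a
proof may run its bootstrap at frozen temperature `κ′ ≍ κ` granted the a-priori floor the ratchet provides.
Why plausibly true: Hintz arXiv:2606.28253 Thm 1.1 gives this at every FIXED `|a| < M` with inexplicit
constants; AKU arXiv:2603.10378 Thm 1 gives the spherical charged analogue with a basin UNIFORM across
extremality; the route's bet (card extremality-is-phase-mixing) is polynomial degeneration. Size: open-problem. -/
theorem stub_closedFamilyCapture [Kerr.Facts] [Kerr.SliceFacts] :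
    ∃ a₁ : ℝ, a₁ < 1 ∧ ∀ k : ℕ, ∃ N₀ q : ℕ, ∀ (s : ℕ) (δ γ : ℝ),
      N₀ ≤ s → (N₀ : ℝ) ≤ δ → (N₀ : ℝ) ≤ γ →
      ∀ (M : ℝ) (hM : 0 < M), ∃ c > (0 : ℝ), ∃ C : ℝ, ∀ a : ℝ, a₁ * M ≤ |a| →
        Kerr.IsSubextremal M a →
          ∀ (D : InitialDataSet 𝓘(ℝ, E3) (Kerr.slice a M)) [D.metric.HasLeviCivita],
            D.IsVacuumConstraintSolution →
              InitialDataSet.dataWeightedSobolevEDist s δ D (Kerr.data M a M hM.le) <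
                  ENNReal.ofReal (c * (1 - (a / M) ^ 2) ^ γ) →
                ∀ 𝒟 : VacuumCauchyDevelopment D, 𝒟.IsMaximal →
                  ∃ (M' a' : ℝ) (𝒟oc : Set 𝒟.carrier), 0 < M' ∧ |a'| ≤ M' ∧
                    𝒟.toSpacetime.ConvergesToKerr 𝒟oc M' a' k ∧
                      |a' * M' - a * M| ≤ C * (1 - (a / M) ^ 2) ^ (-(q : ℝ)) *
                        √(InitialDataSet.dataWeightedSobolevEDist s δ D
                          (Kerr.data M a M hM.le)).toReal := by
  sorry

/-- **Stub F — `stub_farCompleteness` (null infinity of a captured development is complete).** There are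
thresholds `k₀, N₀` such that for `s, δ, γ ≥ N₀`, every `M > 0`, some `c > 0`: if a vacuum datum on the
Kerr–Schild slice lies in the basin `dist < c (1 − a²/M²)^γ` (`|a| < M`) and a maximal vacuum Cauchy development
of it contains a late region converging in `C^{k₀}` to some Kerr exterior `g_{M′,a′}` (`0 < M′`, `|a′| ≤ M′`),
then that development has complete future null infinity in the far-origin sojourn form `FarComplete` (verbatim
the crux's second conjunct). Why plausibly true: far-out null rays either stay in the weak-field zone
(Klainerman–Nicolò exterior stability, peeling-free) or enter the late Kerr-like end, where outgoing rays are
complete and ingoing ones sojourn `≳ r` in `J⁺(B₀)`; this is the "completeness of 𝓘⁺" chapter of DHRT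
arXiv:2104.08222 §1 / Klainerman–Szeftel Thm 1.1 separated from the decay estimates. Why it might fail: the
sojourn form quantifies over ALL far origins at `t* = 0`, so it needs the early far region too (Cauchy
stability + Klainerman–Nicolò), not only the late chart. Size L. -/
theorem stub_farCompleteness [Kerr.Facts] [Kerr.SliceFacts] :
    ∃ (k₀ N₀ : ℕ), ∀ (s : ℕ) (δ γ : ℝ), N₀ ≤ s → (N₀ : ℝ) ≤ δ → (N₀ : ℝ) ≤ γ →
      ∀ (M : ℝ) (hM : 0 < M), ∃ c > (0 : ℝ), ∀ a : ℝ, Kerr.IsSubextremal M a →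
        ∀ (D : InitialDataSet 𝓘(ℝ, E3) (Kerr.slice a M)) [D.metric.HasLeviCivita],
          D.IsVacuumConstraintSolution →
            InitialDataSet.dataWeightedSobolevEDist s δ D (Kerr.data M a M hM.le) <
                ENNReal.ofReal (c * (1 - (a / M) ^ 2) ^ γ) →
              ∀ 𝒟 : VacuumCauchyDevelopment D, 𝒟.IsMaximal →
                ∀ (M' a' : ℝ) (𝒟oc : Set 𝒟.carrier), 0 < M' → |a'| ≤ M' →
                  𝒟.toSpacetime.ConvergesToKerr 𝒟oc M' a' k₀ → FarComplete 𝒟 := by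
  sorry

/-- **Stub α — `stub_massBound` (NO MASS GAIN: Bondi mass loss, read at infinity).** There are thresholds
`k₀, N₀` such that for `s, δ, γ ≥ N₀`, every `M > 0`, some `c > 0` and `C`: for basin data with a maximal
development that is far-complete and contains a late region converging in `C^{k₀}` to `g_{M′,a′}`
(`0 < M′`, `|a′| ≤ M′`), the final mass obeys `M′ ≤ M + C (1 − a²/M²)^{-q} √dist` (loss allowed, none
expected). Why plausibly true: `M′` is the rest mass of
the final state, `≤` final Bondi energy `≤` initial Bondi energy `=` `E_ADM(D)` (positivity of the Bondi
flux, `BondiFoliation.bondiMass_antitone`, `finalBondiMass_le_admEnergy` in the tree under their hypotheses),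
and `E_ADM(D) = M` EXACTLY once `δ > −1/2` (finite `H^s_δ`-distance pins the `1/r` term; triage r1-2 R2), so
even `C = 0` is expected. Why it might fail: identifying the parameter `M′` of the `Cᵏ` sup-norm limit on
`t*`-slabs with the final Bondi rest mass needs the convergence to reach null infinity in a peeling-free sense
(`NonSmoothNullInfinity` caveat) — the stub only needs the INEQUALITY, provable from a positive-energy argument
on asymptotically hyperboloidal slices if Bondi mass is unavailable. Size M–L. -/
theorem stub_massBound [Kerr.Facts] [Kerr.SliceFacts] :
    ∃ (k₀ N₀ q : ℕ), ∀ (s : ℕ) (δ γ : ℝ), N₀ ≤ s → (N₀ : ℝ) ≤ δ → (N₀ : ℝ) ≤ γ →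
      ∀ (M : ℝ) (hM : 0 < M), ∃ c > (0 : ℝ), ∃ C : ℝ, ∀ a : ℝ, Kerr.IsSubextremal M a →
        ∀ (D : InitialDataSet 𝓘(ℝ, E3) (Kerr.slice a M)) [D.metric.HasLeviCivita],
          D.IsVacuumConstraintSolution →
            InitialDataSet.dataWeightedSobolevEDist s δ D (Kerr.data M a M hM.le) <
                ENNReal.ofReal (c * (1 - (a / M) ^ 2) ^ γ) →
              ∀ 𝒟 : VacuumCauchyDevelopment D, 𝒟.IsMaximal → FarComplete 𝒟 →
                ∀ (M' a' : ℝ) (𝒟oc : Set 𝒟.carrier), 0 < M' → |a'| ≤ M' →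
                  𝒟.toSpacetime.ConvergesToKerr 𝒟oc M' a' k₀ →
                    M' ≤ M + C * (1 - (a / M) ^ 2) ^ (-(q : ℝ)) *
                      √(InitialDataSet.dataWeightedSobolevEDist s δ D (Kerr.data M a M hM.le)).toReal := by
  sorry

/-- **Stub β — `stub_areaRatchet` (THE RATCHET: Hawking's area theorem against a trapped collar).** There are
thresholds `k₀, N₀, q` such that for `s, δ, γ ≥ N₀`, every `M > 0`, some `c > 0` and `C`: for basin data with a
far-complete maximal development containing a late region converging in `C^{k₀}` to `g_{M′,a′}` (`0 < M′`,
`|a′| ≤ M′`), the normalised final horizon area dominates the initial Kerr one up to a κ-polynomial deficit: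
`M r₊(M,a) − C M² (1 − a²/M²)^{-q} √dist ≤ M′ r₊(M′,a′)` (`A_Kerr = 8π M r₊`; the deficit is in truth
LINEAR in the amplitude `dist ≤ √dist` with `q = 1/2`, see (β₁)). Internal plan (three lemmas, to
ride with `--supports`): (β₁) COLLAR CERTIFICATE in the data — the coordinate sphere `{r = r₊ − θM√χ}` of the
slice, `θ = K·dist/χ ≤ 1/2` (needs `γ ≥ 1`: the refuter's necessary exponent read positively), is TRAPPED for
`D` and has `D`-area `≥ 8π M r₊ − C M² χ^{-1/2} dist` (`t*`-sections of `{r = const}` are isometric to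
Boyer–Lindquist `t`-sections, of area `≥ 4π(r² + a²)` wherever `Δ ≤ 0`, equality at `r = r₊`; ideator-3 desk
check ks_slice_checks; triage r1-2 E4: displacement factor `∂r₊/∂M ≍ χ^{-1/2}`, so `q = 1` suffices here);
(β₂) trapped surfaces of a far-complete development lie in the black-hole region and the event-horizon section
areas dominate the area of an enclosed trapped sphere inside the mean-convex foliation `{M ≤ r ≤ 3M}`
(`H_r > 0`, outer-minimising hull / `AFEnd.minimalEnclosureArea`), then CDGH area theorem
(`ChruscielEtAl2001_areaTheorem`, `VacuumCauchyDevelopment.monotone_horizonArea`); (β₃) FINAL AREA — along the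
late chart the section areas tend to `8π M′ r₊(M′,a′)` (`k₀ ≥ 1`). Why it might fail: (β₃) needs `C¹` control up
to and across `r = r₊′` while `ConvergesToKerr` is a sup-norm statement on the open exterior (area is only lower
semicontinuous under `C⁰`; triage r1-3 (b)) — but LOWER semicontinuity is the direction needed here; the
displacement exponent may exceed `1/2` (MOTS-stability gap `λ₁ ∝ κ^{q′}`, Mars arXiv:1205.1724), which only
raises `q`. Size L. -/
theorem stub_areaRatchet [Kerr.Facts] [Kerr.SliceFacts] :
    ∃ (k₀ N₀ q : ℕ), ∀ (s : ℕ) (δ γ : ℝ), N₀ ≤ s → (N₀ : ℝ) ≤ δ → (N₀ : ℝ) ≤ γ →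
      ∀ (M : ℝ) (hM : 0 < M), ∃ c > (0 : ℝ), ∃ C : ℝ, ∀ a : ℝ, Kerr.IsSubextremal M a →
        ∀ (D : InitialDataSet 𝓘(ℝ, E3) (Kerr.slice a M)) [D.metric.HasLeviCivita],
          D.IsVacuumConstraintSolution →
            InitialDataSet.dataWeightedSobolevEDist s δ D (Kerr.data M a M hM.le) <
                ENNReal.ofReal (c * (1 - (a / M) ^ 2) ^ γ) →
              ∀ 𝒟 : VacuumCauchyDevelopment D, 𝒟.IsMaximal → FarComplete 𝒟 →
                ∀ (M' a' : ℝ) (𝒟oc : Set 𝒟.carrier), 0 < M' → |a'| ≤ M' →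
                  𝒟.toSpacetime.ConvergesToKerr 𝒟oc M' a' k₀ →
                    M * Kerr.rPlus M a - C * M ^ 2 * (1 - (a / M) ^ 2) ^ (-(q : ℝ)) *
                        √(InitialDataSet.dataWeightedSobolevEDist s δ D (Kerr.data M a M hM.le)).toReal ≤
                      M' * Kerr.rPlus M' a' := by
  sorry

/-! ## Real arithmetic of the ratchet (kernel-checked, no `sorry`) -/

/-- `J'² ≥ J² − 2|J|ε` whenever `|J' − J| ≤ ε`. -/
theorem sq_sub_le_sq_of_abs_sub_le {J J' ε : ℝ} (h : |J' - J| ≤ ε) :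
    J ^ 2 - 2 * |J| * ε ≤ J' ^ 2 := by
  have hε : 0 ≤ ε := (abs_nonneg _).trans h
  have h1 : |J| - |J'| ≤ ε := by
    calc |J| - |J'| ≤ |J - J'| := abs_sub_abs_le_abs_sub J J'
      _ = |J' - J| := abs_sub_comm J J'
      _ ≤ ε := h
  have hJ2 : J ^ 2 = |J| ^ 2 := (sq_abs J).symm
  have hJ'2 : J' ^ 2 = |J'| ^ 2 := (sq_abs J').symm
  rcases le_or_gt |J| |J'| with hle | hlt
  · have h3 : |J| ^ 2 ≤ |J'| ^ 2 := pow_le_pow_left₀ (abs_nonneg J) hle 2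
    have h4 : 0 ≤ 2 * |J| * ε := by positivity
    rw [hJ2, hJ'2]
    linarith
  · have h2 : |J| ^ 2 - |J'| ^ 2 = (|J| - |J'|) * (|J| + |J'|) := by ring
    have h3 : (|J| - |J'|) * (|J| + |J'|) ≤ ε * (|J| + |J'|) :=
      mul_le_mul_of_nonneg_right h1 (by positivity)
    have h4 : ε * (|J| + |J'|) ≤ ε * (2 * |J|) :=
      mul_le_mul_of_nonneg_left (by linarith) hε
    have h5 : ε * (2 * |J|) = 2 * |J| * ε := by ring
    rw [hJ2, hJ'2]
    linarith

/-- Polynomial core of the first-law steepness estimate: from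
`(M S + y M − ε_β)² ≤ M² S² − y M³ + 2 M² ε_γ` with `y ≥ 0`, `ε_β ≤ M S`, `0 < M`, conclude
`y M² ≤ 2 M ε_γ + 2 S ε_β`. -/
theorem steep_core {M y S εβ εγ : ℝ} (hM : 0 < M) (hy : 0 ≤ y) (hSe : εβ ≤ M * S)
    (h : (M * S + y * M - εβ) ^ 2 ≤ M ^ 2 * S ^ 2 - y * M ^ 3 + 2 * M ^ 2 * εγ) :
    y * M ^ 2 ≤ 2 * M * εγ + 2 * S * εβ := by
  have hprod : 0 ≤ (y * M) * (M * S - εβ) := mul_nonneg (mul_nonneg hy hM.le) (by linarith)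
  have hexp : (M * S + y * M - εβ) ^ 2 =
      M ^ 2 * S ^ 2 + (y * M) ^ 2 + εβ ^ 2 + 2 * ((y * M) * (M * S - εβ)) - 2 * M * S * εβ := by
    ring
  have h1 : y * M ^ 3 ≤ 2 * M ^ 2 * εγ + 2 * M * S * εβ := by
    nlinarith [sq_nonneg (y * M), sq_nonneg εβ, hprod, hexp, h]
  have h2 : M * (y * M ^ 2) ≤ M * (2 * M * εγ + 2 * S * εβ) := by
    have e1 : M * (y * M ^ 2) = y * M ^ 3 := by ring
    have e2 : M * (2 * M * εγ + 2 * S * εβ) = 2 * M ^ 2 * εγ + 2 * M * S * εβ := by ring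
    rw [e1, e2]
    exact h1
  exact le_of_mul_le_mul_left h2 hM

/-- **First-law steepness (the ratchet's teeth).** If the final Kerr parameters `(M', a')` with
`0 < M' ≤ M`, `|a'| ≤ M'` have normalised horizon area `M' r₊(M', a') = A'/8π` at least
`M r₊(M, a) − ε_β` and angular momentum `|a'M' − aM| ≤ ε_γ`, then the mass can have DROPPED only by
`(M − M') M² ≤ 2 M ε_γ + 2 √(M² − a²) ε_β`: the area is steep in the mass at fixed angular momentum
near extremality (`∂(A/8π)/∂M |_J ≍ M/√(1 − a²/M²)`), so an area deficit `ε_β` of size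
`M² (1 − a²/M²)^{-1/2} · dist` costs only `O(M · dist)` in mass, UNIFORMLY in the surface gravity. -/
theorem mass_drop_le_of_budgets {M a M' a' εβ εγ : ℝ} (hM : 0 < M) (ha : |a| < M)
    (hM'0 : 0 < M') (hM'M : M' ≤ M) (ha' : |a'| ≤ M') (hεγ : 0 ≤ εγ)
    (hβ : M * Kerr.rPlus M a - εβ ≤ M' * Kerr.rPlus M' a')
    (hγ : |a' * M' - a * M| ≤ εγ) (hβs : εβ ≤ M * √(M ^ 2 - a ^ 2)) :
    (M - M') * M ^ 2 ≤ 2 * M * εγ + 2 * √(M ^ 2 - a ^ 2) * εβ := by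
  have hS0 : 0 ≤ √(M ^ 2 - a ^ 2) := Real.sqrt_nonneg _
  have haM0 : |a| * M ≤ M ^ 2 := by
    calc |a| * M ≤ M * M := mul_le_mul_of_nonneg_right ha.le hM.le
      _ = M ^ 2 := (sq M).symm
  have hMa : 0 ≤ M ^ 2 - a ^ 2 := by
    have : |a| ^ 2 ≤ M ^ 2 := pow_le_pow_left₀ (abs_nonneg a) ha.le 2
    rw [sq_abs] at this
    linarith
  have hSsq : √(M ^ 2 - a ^ 2) ^ 2 = M ^ 2 - a ^ 2 := Real.sq_sqrt hMa
  have hrp : Kerr.rPlus M a = M + √(M ^ 2 - a ^ 2) := rfl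
  have hrp' : Kerr.rPlus M' a' = M' + √(M' ^ 2 - a' ^ 2) := rfl
  have ha'sq : a' ^ 2 ≤ M' ^ 2 := by
    have : |a'| ^ 2 ≤ M' ^ 2 := pow_le_pow_left₀ (abs_nonneg a') ha' 2
    rwa [sq_abs] at this
  have hVsq : (M' * √(M' ^ 2 - a' ^ 2)) ^ 2 = M' ^ 2 * (M' ^ 2 - a' ^ 2) := by
    rw [mul_pow, Real.sq_sqrt (sub_nonneg.2 ha'sq)]
  -- the area hypothesis, unfolded
  have e1 : M * Kerr.rPlus M a = M ^ 2 + M * √(M ^ 2 - a ^ 2) := by rw [hrp]; ring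
  have e2 : M' * Kerr.rPlus M' a' = M' ^ 2 + M' * √(M' ^ 2 - a' ^ 2) := by rw [hrp']; ring
  rw [e1, e2] at hβ
  have hy0 : 0 ≤ M - M' := by linarith
  have h7 : (M - M') * M ≤ M ^ 2 - M' ^ 2 := by
    rw [show M ^ 2 - M' ^ 2 = (M - M') * M + (M - M') * M' by ring]
    linarith [mul_nonneg hy0 hM'0.le]
  have hyM0 : 0 ≤ (M - M') * M := mul_nonneg hy0 hM.le
  have hT0 : 0 ≤ M * √(M ^ 2 - a ^ 2) + (M - M') * M - εβ := by linarith
  have hTle : M * √(M ^ 2 - a ^ 2) + (M - M') * M - εβ ≤ M' * √(M' ^ 2 - a' ^ 2) := by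
    linarith
  have hTsq : (M * √(M ^ 2 - a ^ 2) + (M - M') * M - εβ) ^ 2 ≤ M' ^ 2 * (M' ^ 2 - a' ^ 2) := by
    rw [← hVsq]
    exact pow_le_pow_left₀ hT0 hTle 2
  -- angular momentum budget: (a'M')² ≥ (aM)² − 2M²εγ
  have hJ : (a * M) ^ 2 - 2 * M ^ 2 * εγ ≤ (a' * M') ^ 2 := by
    have h1 := sq_sub_le_sq_of_abs_sub_le hγ
    have h2 : |a * M| ≤ M ^ 2 := by rw [abs_mul, abs_of_pos hM]; exact haM0
    have h3 : 2 * |a * M| * εγ ≤ 2 * M ^ 2 * εγ :=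
      mul_le_mul_of_nonneg_right (by linarith) hεγ
    linarith
  -- M'⁴ ≤ M' M³
  have h4 : M' ^ 4 ≤ M' * M ^ 3 := by
    have h3 : M' ^ 3 ≤ M ^ 3 := pow_le_pow_left₀ hM'0.le hM'M 3
    calc M' ^ 4 = M' * M' ^ 3 := by ring
      _ ≤ M' * M ^ 3 := mul_le_mul_of_nonneg_left h3 hM'0.le
  -- combine into the hypothesis of `steep_core`
  have hstar : (M * √(M ^ 2 - a ^ 2) + (M - M') * M - εβ) ^ 2 ≤
      M ^ 2 * √(M ^ 2 - a ^ 2) ^ 2 - (M - M') * M ^ 3 + 2 * M ^ 2 * εγ := by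
    have haMsq : (a * M) ^ 2 = a ^ 2 * M ^ 2 := by ring
    have haM'sq : M' ^ 2 * (M' ^ 2 - a' ^ 2) = M' ^ 4 - (a' * M') ^ 2 := by ring
    have hR : M ^ 2 * √(M ^ 2 - a ^ 2) ^ 2 - (M - M') * M ^ 3 + 2 * M ^ 2 * εγ =
        M' * M ^ 3 - a ^ 2 * M ^ 2 + 2 * M ^ 2 * εγ := by
      rw [hSsq]; ring
    rw [hR]
    rw [haM'sq] at hTsq
    rw [haMsq] at hJ
    linarith
  exact steep_core hM hy0 hβs hstar

/-- **The laws pin the parameters (modulus from the budgets).** From the three budgets — mass loss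
`M' ≤ M + ε_α`, area ratchet `M' r₊(M',a') ≥ M r₊(M,a) − ε_β`, angular-momentum bookkeeping
`|a'M' − aM| ≤ ε_γ` — with `ε_β ≤ (M²/16)√(1 − a²/M²)` and `ε_γ ≤ M²/16`, the final parameters are
pinned: `|M' − M| + |a' − a| ≤ 3 ε_α + (8 ε_γ + 6 ε_β)/M`. In the skeleton `ε_α = C dist`,
`ε_β = C M² χ^{-q} dist`, `ε_γ = C χ^{-q} dist`, so the modulus exponent is `p = q` (and `p = 0` when
the area-deficit law has loss `χ^{-1/2}` and `J` is conserved — the card's axisymmetric prediction). -/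
theorem modulus_of_budgets {M a M' a' εα εβ εγ : ℝ} (hM : 0 < M) (ha : |a| < M)
    (hM'0 : 0 < M') (ha' : |a'| ≤ M') (hεα : 0 ≤ εα) (hεβ : 0 ≤ εβ) (hεγ : 0 ≤ εγ)
    (hα : M' ≤ M + εα) (hβ : M * Kerr.rPlus M a - εβ ≤ M' * Kerr.rPlus M' a')
    (hγ : |a' * M' - a * M| ≤ εγ) (hβs : εβ ≤ M ^ 2 / 16 * √(1 - (a / M) ^ 2))
    (hγs : εγ ≤ M ^ 2 / 16) :
    |M' - M| + |a' - a| ≤ 3 * εα + (8 * εγ + 6 * εβ) / M := by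
  have hS0 : 0 ≤ √(M ^ 2 - a ^ 2) := Real.sqrt_nonneg _
  have hSM : √(M ^ 2 - a ^ 2) ≤ M := by
    calc √(M ^ 2 - a ^ 2) ≤ √(M ^ 2) := Real.sqrt_le_sqrt (by nlinarith [sq_nonneg a])
      _ = M := Real.sqrt_sq hM.le
  have hsq : √(1 - (a / M) ^ 2) = √(M ^ 2 - a ^ 2) / M := Kerr.sqrt_one_sub_div_sq hM a
  have hsq1 : √(1 - (a / M) ^ 2) ≤ 1 := by
    rw [hsq, div_le_one hM]; exact hSM
  -- εβ ≤ M √(M² − a²) and εβ ≤ M²/16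
  have hβs1 : εβ ≤ M * √(M ^ 2 - a ^ 2) := by
    have e : M ^ 2 / 16 * √(1 - (a / M) ^ 2) = M * √(M ^ 2 - a ^ 2) / 16 := by
      rw [hsq]; field_simp
    rw [e] at hβs
    have : 0 ≤ M * √(M ^ 2 - a ^ 2) := mul_nonneg hM.le hS0
    linarith
  have hβs2 : εβ ≤ M ^ 2 / 16 :=
    hβs.trans (mul_le_of_le_one_right (by positivity) hsq1)
  -- lower mass bound
  have hlow : (M - M') * M ^ 2 ≤ 2 * M * εγ + 2 * √(M ^ 2 - a ^ 2) * εβ := by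
    rcases le_or_gt M' M with hle | hlt
    · exact mass_drop_le_of_budgets hM ha hM'0 hle ha' hεγ hβ hγ hβs1
    · have h1 : (M - M') * M ^ 2 ≤ 0 :=
        mul_nonpos_of_nonpos_of_nonneg (by linarith) (sq_nonneg M)
      have h2 : 0 ≤ 2 * M * εγ := by positivity
      have h3 : 0 ≤ 2 * √(M ^ 2 - a ^ 2) * εβ := by positivity
      linarith
  have hlow' : M - M' ≤ (2 * εγ + 2 * εβ) / M := by
    rw [le_div_iff₀ hM]
    have h1 : 2 * √(M ^ 2 - a ^ 2) * εβ ≤ 2 * M * εβ := by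
      have := mul_le_mul_of_nonneg_right hSM hεβ
      linarith
    have h2 : M * ((M - M') * M) ≤ M * (2 * εγ + 2 * εβ) := by
      have e1 : M * ((M - M') * M) = (M - M') * M ^ 2 := by ring
      have e2 : M * (2 * εγ + 2 * εβ) = 2 * M * εγ + 2 * M * εβ := by ring
      rw [e1, e2]
      linarith
    exact le_of_mul_le_mul_left h2 hM
  have hdiv0 : 0 ≤ (2 * εγ + 2 * εβ) / M := by positivity
  have habsM : |M' - M| ≤ εα + (2 * εγ + 2 * εβ) / M := by
    rw [abs_le]
    constructor
    · linarith
    · linarith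
  -- M' ≥ M/2
  have hquarter : (2 * εγ + 2 * εβ) / M ≤ M / 4 := by
    rw [div_le_iff₀ hM]
    have : M / 4 * M = M ^ 2 / 4 := by ring
    rw [this]
    linarith
  have hM'half : M / 2 ≤ M' := by linarith
  -- spin
  have hspin : |a' - a| * M' ≤ εγ + M * |M' - M| := by
    have hid : (a' - a) * M' = (a' * M' - a * M) - a * (M' - M) := by ring
    have h1 : |a| * |M' - M| ≤ M * |M' - M| := mul_le_mul_of_nonneg_right ha.le (abs_nonneg _)
    calc |a' - a| * M' = |(a' - a) * M'| := by rw [abs_mul, abs_of_pos hM'0]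
      _ = |(a' * M' - a * M) - a * (M' - M)| := by rw [hid]
      _ ≤ |a' * M' - a * M| + |a * (M' - M)| := abs_sub _ _
      _ = |a' * M' - a * M| + |a| * |M' - M| := by rw [abs_mul]
      _ ≤ εγ + M * |M' - M| := by linarith
  have hspin2 : |a' - a| * M ≤ 2 * εγ + 2 * M * |M' - M| := by
    have h1 : |a' - a| * (M / 2) ≤ |a' - a| * M' :=
      mul_le_mul_of_nonneg_left hM'half (abs_nonneg (a' - a))
    calc |a' - a| * M = 2 * (|a' - a| * (M / 2)) := by ring
      _ ≤ 2 * (|a' - a| * M') := by linarith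
      _ ≤ 2 * (εγ + M * |M' - M|) := by linarith
      _ = 2 * εγ + 2 * M * |M' - M| := by ring
  have hspin' : |a' - a| ≤ 2 * εγ / M + 2 * |M' - M| := by
    have h3 : |a' - a| ≤ (2 * εγ + 2 * M * |M' - M|) / M := by
      rw [le_div_iff₀ hM]; exact hspin2
    calc |a' - a| ≤ (2 * εγ + 2 * M * |M' - M|) / M := h3
      _ = 2 * εγ / M + 2 * |M' - M| := by field_simp
  calc |M' - M| + |a' - a| ≤ 3 * |M' - M| + 2 * εγ / M := by
        linarith [abs_nonneg (M' - M)]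
    _ ≤ 3 * (εα + (2 * εγ + 2 * εβ) / M) + 2 * εγ / M := by linarith
    _ = 3 * εα + (8 * εγ + 6 * εβ) / M := by
        field_simp
        ring


/-- Real-arithmetic core of the landed redundancy lemma `Negative.isSubextremal_of_drift`
(`Theorems/NearExtremalKappaCapture/Negative/SubextremalRedundancy.lean`, p74448; re-proved verbatim here because
that module was unbuilt on the farm at check time): a drift `≤ Mχ/4` from a sub-extremal `(M, a)` lands on a
sub-extremal pair. -/
theorem isSubextremal_of_drift' {M a M' a' : ℝ} (hM : 0 < M) (hsub : Kerr.IsSubextremal M a)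
    (hdrift : |M' - M| + |a' - a| ≤ M * (1 - (a / M) ^ 2) / 4) : Kerr.IsSubextremal M' a' := by
  have ha : |a| < M := hsub
  have hM0 : M ≠ 0 := hM.ne'
  have key : M * (1 - (a / M) ^ 2) = 2 * (M - |a|) - (M - |a|) ^ 2 / M := by
    rw [div_pow, ← sq_abs a]
    field_simp
    ring
  have hsq : 0 ≤ (M - |a|) ^ 2 / M := div_nonneg (sq_nonneg _) hM.le
  have hx : M * (1 - (a / M) ^ 2) ≤ 2 * (M - |a|) := by rw [key]; linarith
  have h1 : |a'| ≤ |a| + |a' - a| := by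
    calc |a'| = |a + (a' - a)| := by ring_nf
      _ ≤ |a| + |a' - a| := abs_add_le _ _
  have h2 : M - M' ≤ |M' - M| := by
    rw [abs_sub_comm]; exact le_abs_self _
  show |a'| < M'
  nlinarith [abs_nonneg (M' - M), abs_nonneg (a' - a)]

/-! ## The composition (kernel-checked, no `sorry` of its own) -/

/-- `|C| c ≤ 1/16` once `c ≤ 1/(16(|C|+1))`. -/
theorem abs_mul_le_sixteenth {C c : ℝ} (hc : c ≤ 1 / (16 * (|C| + 1))) : |C| * c ≤ 1 / 16 := by
  calc |C| * c ≤ |C| * (1 / (16 * (|C| + 1))) := mul_le_mul_of_nonneg_left hc (abs_nonneg _)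
    _ ≤ 1 / 16 := by
        rw [mul_one_div, div_le_div_iff₀ (by positivity) (by positivity)]
        nlinarith [abs_nonneg C]

/-- `|C| c ≤ M²/16` once `c ≤ M²/(16(|C|+1))`. -/
theorem abs_mul_le_sq_sixteenth {C c M : ℝ} (hc : c ≤ M ^ 2 / (16 * (|C| + 1))) :
    |C| * c ≤ M ^ 2 / 16 := by
  calc |C| * c ≤ |C| * (M ^ 2 / (16 * (|C| + 1))) := mul_le_mul_of_nonneg_left hc (abs_nonneg _)
    _ ≤ M ^ 2 / 16 := by
        rw [mul_div_assoc', div_le_div_iff₀ (by positivity) (by positivity)]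
        have e : M ^ 2 * (16 * (|C| + 1)) - |C| * M ^ 2 * 16 = 16 * M ^ 2 := by ring
        nlinarith [sq_nonneg M, e, abs_nonneg C]

/-- `K c ≤ M/4` once `0 ≤ K`, `0 < M`, `c ≤ M/(4(K+1))`. -/
theorem mul_le_quarter {K c M : ℝ} (hK : 0 ≤ K) (hM : 0 < M) (hc : c ≤ M / (4 * (K + 1))) :
    K * c ≤ M / 4 := by
  calc K * c ≤ K * (M / (4 * (K + 1))) := mul_le_mul_of_nonneg_left hc hK
    _ ≤ M / 4 := by
        rw [mul_div_assoc', div_le_div_iff₀ (by positivity) (by positivity)]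
        have e : M * (4 * (K + 1)) - K * M * 4 = 4 * M := by ring
        nlinarith [e, hM.le]

/-- `x ≤ √x` on `[0, 1]`. -/
theorem le_sqrt_self_of_le_one {x : ℝ} (h0 : 0 ≤ x) (h1 : x ≤ 1) : x ≤ √x := by
  have hs1 : √x ≤ 1 := by
    calc √x ≤ √1 := Real.sqrt_le_sqrt h1
      _ = 1 := Real.sqrt_one
  calc x = √x * √x := (Real.mul_self_sqrt h0).symm
    _ ≤ √x * 1 := mul_le_mul_of_nonneg_left hs1 (Real.sqrt_nonneg _)
    _ = √x := mul_one _

set_option maxHeartbeats 800000 in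
/-- **The four stubs give `CaptureWith N N k N q a₁`** on the diagonal of the exponent up-set: `a₁` and, for
`k := k_F + k_α + k_β`, the thresholds `N₀, q_E` from the engine; `q := q_E + q_α + q_β`;
`N := ΣN₀ + 2q + 2` (so `γ = N ≥ 2q + 2`: inside the basin `χ^{-q} √dist ≤ c′ χ`); basin constant `c := c′²`,
`c′ := min(c_E, c_F, c_α, c_β, 1, 1/(16(|C_β|+1)), M²/(16(|C_E|+1)), M/(4(K+1)))`, modulus constant
`K := 3|C_α| + (8|C_E| + 6|C_β|M²)/M`, `p := q`. Then: engine ⇒ limit `(M′, a′)` in the closed family +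
`J`-budget; stub F ⇒ `FarComplete`; stubs α, β ⇒ mass and area budgets; `modulus_of_budgets` ⇒
`|M′−M| + |a′−a| ≤ K χ^{-q} √dist`; and `K χ^{-q} √dist ≤ K c′ χ ≤ Mχ/4` ⇒ sub-extremal limit
(`isSubextremal_of_drift'`). -/
theorem captureWith_of_stubs [Kerr.Facts] [Kerr.SliceFacts] :
    ∃ (s : ℕ) (δ : ℝ) (k : ℕ) (γ p a₁ : ℝ), a₁ < 1 ∧ CaptureWith s δ k γ p a₁ := by
  obtain ⟨a₁, ha₁, hE⟩ := stub_closedFamilyCapture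
  obtain ⟨kF, NF, hF⟩ := stub_farCompleteness
  obtain ⟨kα, Nα, qα, hα⟩ := stub_massBound
  obtain ⟨kβ, Nβ, qβ, hβ⟩ := stub_areaRatchet
  -- common convergence order
  obtain ⟨k, hk⟩ : ∃ k : ℕ, k = kF + kα + kβ := ⟨_, rfl⟩
  have hkF : kF ≤ k := by omega
  have hkα : kα ≤ k := by omega
  have hkβ : kβ ≤ k := by omega
  obtain ⟨NE, qE, hE⟩ := hE k
  -- common loss exponent and common Sobolev / weight / basin exponent
  obtain ⟨q, hq⟩ : ∃ q : ℕ, q = qE + qα + qβ := ⟨_, rfl⟩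
  obtain ⟨N, hN⟩ : ∃ N : ℕ, N = NE + NF + Nα + Nβ + 2 * q + 2 := ⟨_, rfl⟩
  have hNE : NE ≤ N := by omega
  have hNF : NF ≤ N := by omega
  have hNα : Nα ≤ N := by omega
  have hNβ : Nβ ≤ N := by omega
  have hNE' : (NE : ℝ) ≤ N := by exact_mod_cast hNE
  have hNF' : (NF : ℝ) ≤ N := by exact_mod_cast hNF
  have hNα' : (Nα : ℝ) ≤ N := by exact_mod_cast hNα
  have hNβ' : (Nβ : ℝ) ≤ N := by exact_mod_cast hNβ
  have hqN : 2 * (q : ℝ) + 2 ≤ N := by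
    have : 2 * q + 2 ≤ N := by omega
    exact_mod_cast this
  have hqE : (qE : ℝ) ≤ q := by
    have : qE ≤ q := by omega
    exact_mod_cast this
  have hqα : (qα : ℝ) ≤ q := by
    have : qα ≤ q := by omega
    exact_mod_cast this
  have hqβ : (qβ : ℝ) ≤ q := by
    have : qβ ≤ q := by omega
    exact_mod_cast this
  refine ⟨N, N, k, N, q, a₁, ha₁, ?_⟩
  intro M hM
  obtain ⟨cE, hcE, CE, hE⟩ := hE N N N hNE hNE' hNE' M hM
  obtain ⟨cF, hcF, hF⟩ := hF N N N hNF hNF' hNF' M hM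
  obtain ⟨cα, hcα, Cα, hα⟩ := hα N N N hNα hNα' hNα' M hM
  obtain ⟨cβ, hcβ, Cβ, hβ⟩ := hβ N N N hNβ hNβ' hNβ' M hM
  -- the modulus constant `K`, the auxiliary constant `c'` and the basin constant `c := c'²`
  obtain ⟨K, hK⟩ : ∃ K : ℝ, K = 3 * |Cα| + (8 * |CE| + 6 * |Cβ| * M ^ 2) * M⁻¹ := ⟨_, rfl⟩
  have hK0 : 0 ≤ K := by rw [hK]; positivity
  have hp16 : 0 < 1 / (16 * (|Cβ| + 1)) := by positivity
  have hpM : 0 < M ^ 2 / (16 * (|CE| + 1)) := by positivity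
  have hpK : 0 < M / (4 * (K + 1)) := by positivity
  obtain ⟨c', hc'⟩ : ∃ c' : ℝ, c' = min (min (min cE cF) (min cα cβ))
      (min (min 1 (1 / (16 * (|Cβ| + 1)))) (min (M ^ 2 / (16 * (|CE| + 1))) (M / (4 * (K + 1))))) :=
    ⟨_, rfl⟩
  have hc'0 : 0 < c' := by
    rw [hc']
    exact lt_min (lt_min (lt_min hcE hcF) (lt_min hcα hcβ))
      (lt_min (lt_min one_pos hp16) (lt_min hpM hpK))
  have hc'E : c' ≤ cE := hc' ▸ (min_le_left _ _).trans ((min_le_left _ _).trans (min_le_left _ _))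
  have hc'F : c' ≤ cF := hc' ▸ (min_le_left _ _).trans ((min_le_left _ _).trans (min_le_right _ _))
  have hc'α : c' ≤ cα := hc' ▸ (min_le_left _ _).trans ((min_le_right _ _).trans (min_le_left _ _))
  have hc'β : c' ≤ cβ := hc' ▸ (min_le_left _ _).trans ((min_le_right _ _).trans (min_le_right _ _))
  have hc'1 : c' ≤ 1 := hc' ▸ (min_le_right _ _).trans ((min_le_left _ _).trans (min_le_left _ _))
  have hc'16 : c' ≤ 1 / (16 * (|Cβ| + 1)) :=
    hc' ▸ (min_le_right _ _).trans ((min_le_left _ _).trans (min_le_right _ _))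
  have hc'M : c' ≤ M ^ 2 / (16 * (|CE| + 1)) :=
    hc' ▸ (min_le_right _ _).trans ((min_le_right _ _).trans (min_le_left _ _))
  have hc'K : c' ≤ M / (4 * (K + 1)) :=
    hc' ▸ (min_le_right _ _).trans ((min_le_right _ _).trans (min_le_right _ _))
  have h16 : |Cβ| * c' ≤ 1 / 16 := abs_mul_le_sixteenth hc'16
  have hE16 : |CE| * c' ≤ M ^ 2 / 16 := abs_mul_le_sq_sixteenth hc'M
  have hKc : K * c' ≤ M / 4 := mul_le_quarter hK0 hM hc'K
  have hcc' : c' ^ 2 ≤ c' := by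
    rw [sq]; exact (mul_le_mul_of_nonneg_left hc'1 hc'0.le).trans_eq (mul_one c')
  refine ⟨c' ^ 2, pow_pos hc'0 2, K, fun a ha hsub D _ hvac hdist 𝒟 hmax ↦ ?_⟩
  obtain ⟨hx0, hx1⟩ := kappaSq_pos_le_one hsub
  set x : ℝ := 1 - (a / M) ^ 2 with hx
  -- every stub's basin contains ours
  have hbasin : ∀ c₀, c' ≤ c₀ →
      InitialDataSet.dataWeightedSobolevEDist N (N : ℝ) D (Kerr.data M a M hM.le) <
        ENNReal.ofReal (c₀ * x ^ (N : ℝ)) := fun c₀ hc₀ ↦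
    hdist.trans_le (ENNReal.ofReal_le_ofReal
      (mul_le_mul_of_nonneg_right (hcc'.trans hc₀) (Real.rpow_nonneg hx0.le _)))
  -- engine: the limit in the closed family and the angular-momentum budget
  obtain ⟨M', a', 𝒟oc, hM'0, ha'le, hconv, hJ⟩ := hE a ha hsub D hvac (hbasin cE hc'E) 𝒟 hmax
  have hconvF : 𝒟.toSpacetime.ConvergesToKerr 𝒟oc M' a' kF := Spacetime.ConvergesTo.of_le hconv hkF
  have hconvα : 𝒟.toSpacetime.ConvergesToKerr 𝒟oc M' a' kα := Spacetime.ConvergesTo.of_le hconv hkα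
  have hconvβ : 𝒟.toSpacetime.ConvergesToKerr 𝒟oc M' a' kβ := Spacetime.ConvergesTo.of_le hconv hkβ
  -- the three laws
  have hfar : FarComplete 𝒟 :=
    hF a hsub D hvac (hbasin cF hc'F) 𝒟 hmax M' a' 𝒟oc hM'0 ha'le hconvF
  have hmass := hα a hsub D hvac (hbasin cα hc'α) 𝒟 hmax hfar M' a' 𝒟oc hM'0 ha'le hconvα
  have harea := hβ a hsub D hvac (hbasin cβ hc'β) 𝒟 hmax hfar M' a' 𝒟oc hM'0 ha'le hconvβ
  rw [← hx] at hJ hmass harea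
  -- the real distance `d`, its root `√d < c' x^{N/2}` and the loss factor `X = x^{-q}`
  set d : ℝ := (InitialDataSet.dataWeightedSobolevEDist N (N : ℝ) D (Kerr.data M a M hM.le)).toReal
    with hd
  have hd0 : 0 ≤ d := ENNReal.toReal_nonneg
  have hdlt : d < c' ^ 2 * x ^ (N : ℝ) := ENNReal.toReal_lt_of_lt_ofReal hdist
  have hρ0 : 0 ≤ √d := Real.sqrt_nonneg d
  have hρle : √d ≤ c' * x ^ ((N : ℝ) * (1 / 2)) := by
    have h1 : √d ≤ √(c' ^ 2 * x ^ (N : ℝ)) := Real.sqrt_le_sqrt hdlt.le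
    have h2 : √(c' ^ 2 * x ^ (N : ℝ)) = c' * x ^ ((N : ℝ) * (1 / 2)) := by
      rw [Real.sqrt_mul (sq_nonneg c'), Real.sqrt_sq hc'0.le, Real.sqrt_eq_rpow,
        ← Real.rpow_mul hx0.le]
    exact h1.trans_eq h2
  have hX0 : 0 ≤ x ^ (-(q : ℝ)) := Real.rpow_nonneg hx0.le _
  have hXE : x ^ (-(qE : ℝ)) ≤ x ^ (-(q : ℝ)) :=
    Real.rpow_le_rpow_of_exponent_ge hx0 hx1 (by linarith only [hqE])
  have hXα : x ^ (-(qα : ℝ)) ≤ x ^ (-(q : ℝ)) :=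
    Real.rpow_le_rpow_of_exponent_ge hx0 hx1 (by linarith only [hqα])
  have hXβ : x ^ (-(qβ : ℝ)) ≤ x ^ (-(q : ℝ)) :=
    Real.rpow_le_rpow_of_exponent_ge hx0 hx1 (by linarith only [hqβ])
  -- inside the basin the loss is absorbed: `x^{-q} √d ≤ c' x`
  have hXρ : x ^ (-(q : ℝ)) * √d ≤ c' * x := by
    have h1 : x ^ (-(q : ℝ)) * √d ≤ x ^ (-(q : ℝ)) * (c' * x ^ ((N : ℝ) * (1 / 2))) :=
      mul_le_mul_of_nonneg_left hρle hX0
    have h2 : x ^ (-(q : ℝ)) * (c' * x ^ ((N : ℝ) * (1 / 2))) =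
        c' * x ^ (-(q : ℝ) + (N : ℝ) * (1 / 2)) := by
      rw [Real.rpow_add hx0]; ring
    have h3 : x ^ (-(q : ℝ) + (N : ℝ) * (1 / 2)) ≤ x := by
      calc x ^ (-(q : ℝ) + (N : ℝ) * (1 / 2)) ≤ x ^ (1 : ℝ) :=
            Real.rpow_le_rpow_of_exponent_ge hx0 hx1 (by linarith only [hqN])
        _ = x := Real.rpow_one x
    calc x ^ (-(q : ℝ)) * √d ≤ c' * x ^ (-(q : ℝ) + (N : ℝ) * (1 / 2)) := by rw [← h2]; exact h1
      _ ≤ c' * x := mul_le_mul_of_nonneg_left h3 hc'0.le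
  -- the three budgets `εα = |Cα| X √d`, `εβ = |Cβ| M² X √d`, `εγ = |C_E| X √d`, `X = x^{-q}`
  have hεα0 : 0 ≤ |Cα| * (x ^ (-(q : ℝ)) * √d) := mul_nonneg (abs_nonneg _) (mul_nonneg hX0 hρ0)
  have hεβ0 : 0 ≤ |Cβ| * M ^ 2 * (x ^ (-(q : ℝ)) * √d) :=
    mul_nonneg (mul_nonneg (abs_nonneg _) (sq_nonneg _)) (mul_nonneg hX0 hρ0)
  have hεγ0 : 0 ≤ |CE| * (x ^ (-(q : ℝ)) * √d) := mul_nonneg (abs_nonneg _) (mul_nonneg hX0 hρ0)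
  have hαb : M' ≤ M + |Cα| * (x ^ (-(q : ℝ)) * √d) := by
    have h1 : Cα * x ^ (-(qα : ℝ)) * √d ≤ |Cα| * x ^ (-(qα : ℝ)) * √d :=
      mul_le_mul_of_nonneg_right
        (mul_le_mul_of_nonneg_right (le_abs_self Cα) (Real.rpow_nonneg hx0.le _)) hρ0
    have h2 : |Cα| * x ^ (-(qα : ℝ)) * √d ≤ |Cα| * (x ^ (-(q : ℝ)) * √d) := by
      rw [mul_assoc]
      exact mul_le_mul_of_nonneg_left (mul_le_mul_of_nonneg_right hXα hρ0) (abs_nonneg _)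
    linarith only [hmass, h1, h2]
  have hγb : |a' * M' - a * M| ≤ |CE| * (x ^ (-(q : ℝ)) * √d) := by
    have h1 : CE * x ^ (-(qE : ℝ)) * √d ≤ |CE| * x ^ (-(qE : ℝ)) * √d :=
      mul_le_mul_of_nonneg_right
        (mul_le_mul_of_nonneg_right (le_abs_self CE) (Real.rpow_nonneg hx0.le _)) hρ0
    have h2 : |CE| * x ^ (-(qE : ℝ)) * √d ≤ |CE| * (x ^ (-(q : ℝ)) * √d) := by
      rw [mul_assoc]
      exact mul_le_mul_of_nonneg_left (mul_le_mul_of_nonneg_right hXE hρ0) (abs_nonneg _)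
    exact hJ.trans (h1.trans h2)
  have hβb : M * Kerr.rPlus M a - |Cβ| * M ^ 2 * (x ^ (-(q : ℝ)) * √d) ≤ M' * Kerr.rPlus M' a' := by
    have h1 : Cβ * M ^ 2 * x ^ (-(qβ : ℝ)) * √d ≤ |Cβ| * M ^ 2 * x ^ (-(qβ : ℝ)) * √d :=
      mul_le_mul_of_nonneg_right (mul_le_mul_of_nonneg_right
        (mul_le_mul_of_nonneg_right (le_abs_self Cβ) (sq_nonneg M)) (Real.rpow_nonneg hx0.le _)) hρ0
    have h2 : |Cβ| * M ^ 2 * x ^ (-(qβ : ℝ)) * √d ≤ |Cβ| * M ^ 2 * (x ^ (-(q : ℝ)) * √d) := by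
      rw [mul_assoc (|Cβ| * M ^ 2)]
      exact mul_le_mul_of_nonneg_left (mul_le_mul_of_nonneg_right hXβ hρ0)
        (mul_nonneg (abs_nonneg _) (sq_nonneg _))
    linarith only [harea, h1, h2]
  -- smallness of the budgets inside the basin
  have hεβs : |Cβ| * M ^ 2 * (x ^ (-(q : ℝ)) * √d) ≤ M ^ 2 / 16 * √x := by
    have h1 : |Cβ| * M ^ 2 * (x ^ (-(q : ℝ)) * √d) ≤ |Cβ| * M ^ 2 * (c' * x) :=
      mul_le_mul_of_nonneg_left hXρ (mul_nonneg (abs_nonneg _) (sq_nonneg _))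
    have h2 : |Cβ| * M ^ 2 * (c' * x) = (|Cβ| * c') * M ^ 2 * x := by ring
    have h3 : (|Cβ| * c') * M ^ 2 * x ≤ (1 / 16) * M ^ 2 * x :=
      mul_le_mul_of_nonneg_right (mul_le_mul_of_nonneg_right h16 (sq_nonneg M)) hx0.le
    have h4 : (1 / 16) * M ^ 2 * x ≤ (1 / 16) * M ^ 2 * √x :=
      mul_le_mul_of_nonneg_left (le_sqrt_self_of_le_one hx0.le hx1) (by positivity)
    calc |Cβ| * M ^ 2 * (x ^ (-(q : ℝ)) * √d) ≤ (|Cβ| * c') * M ^ 2 * x := by rw [← h2]; exact h1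
      _ ≤ (1 / 16) * M ^ 2 * √x := h3.trans h4
      _ = M ^ 2 / 16 * √x := by ring
  have hεγs : |CE| * (x ^ (-(q : ℝ)) * √d) ≤ M ^ 2 / 16 := by
    have h1 : |CE| * (x ^ (-(q : ℝ)) * √d) ≤ |CE| * (c' * x) :=
      mul_le_mul_of_nonneg_left hXρ (abs_nonneg _)
    have h2 : |CE| * (c' * x) ≤ |CE| * c' :=
      mul_le_mul_of_nonneg_left (mul_le_of_le_one_right hc'0.le hx1) (abs_nonneg _)
    linarith only [h1, h2, hE16]
  -- the laws pin the parameters (first-law steepness): modulus `K x^{-q} √d`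
  have hmod : |M' - M| + |a' - a| ≤ 3 * (|Cα| * (x ^ (-(q : ℝ)) * √d)) +
      (8 * (|CE| * (x ^ (-(q : ℝ)) * √d)) + 6 * (|Cβ| * M ^ 2 * (x ^ (-(q : ℝ)) * √d))) / M :=
    modulus_of_budgets hM hsub hM'0 ha'le hεα0 hεβ0 hεγ0 hαb hβb hγb hεβs hεγs
  have e : 3 * (|Cα| * (x ^ (-(q : ℝ)) * √d)) +
      (8 * (|CE| * (x ^ (-(q : ℝ)) * √d)) + 6 * (|Cβ| * M ^ 2 * (x ^ (-(q : ℝ)) * √d))) / M =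
      K * (x ^ (-(q : ℝ)) * √d) := by
    rw [hK, div_eq_mul_inv]; ring
  have hdrift : |M' - M| + |a' - a| ≤ K * (x ^ (-(q : ℝ)) * √d) := hmod.trans_eq e
  have hmodulus : |M' - M| + |a' - a| ≤ K * x ^ (-(q : ℝ)) * √d := by
    rw [mul_assoc]; exact hdrift
  -- sub-extremality of the limit from the pinned drift `≤ K c' x ≤ M x / 4`
  have hsub' : Kerr.IsSubextremal M' a' := by
    apply isSubextremal_of_drift' hM hsub
    have h1 : K * (x ^ (-(q : ℝ)) * √d) ≤ K * (c' * x) := mul_le_mul_of_nonneg_left hXρ hK0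
    calc |M' - M| + |a' - a| ≤ K * (c' * x) := hdrift.trans h1
      _ = (K * c') * x := by ring
      _ ≤ (M / 4) * x := mul_le_mul_of_nonneg_right hKc hx0.le
      _ = M * x / 4 := by ring
  exact ⟨M', a', 𝒟oc, hsub', hfar, hconv, hmodulus⟩

/-- **The crux, BY NAME, from the four registered stubs** (read-back `Negative.near_iff`, p73006: the crux is
`∀ [Kerr.Facts] [Kerr.SliceFacts], ∃ (s δ k γ p a₁), a₁ < 1 ∧ CaptureWith s δ k γ p a₁`). -/
theorem NearExtremalKappaCapture_of :
    Summit.FinalStateConjecture.FinalStateConjecture.Theses.PhaseMixingCapture.NearExtremalKappaCapture :=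
  near_iff.mpr fun {_ _} ↦ captureWith_of_stubs

end Summit.FinalStateConjecture.FinalStateConjecture.Cruxes.NearExtremalKappaCapture.AreaExcessRatchet

end
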